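import Summits.BirchSwinnertonDyer.Rank1Residual.Additive.KatoDescentKummerUnramifiedMordellWeil
import HarnessLib

set_option autoImplicit false

/-!
# Route `ErratumRoadFive`, crux 19715 `EulerHalfNotRamNoInertSetAtFive`, line `kato_Fframe` (r5.4), stub S1Λ
# `stub_katoLambdaLogBoundTamagawa` — HELPER R-C re-thread C: Part 29 of cell bsd-cm with «additive ⟹ `E(K_v^nr)[p^∞]` killed by `p`»
# replaced by the LOCAL BINDER (E) (one exponent `e` killing `E(K_v)[p^∞]`)

Seat `bsd-line-er5-p1` (LEAD g9), `--supports stmt-BirchSwinnertonDyer-19715` (helper). Theorems only: no definition, no named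
fact, no instance, no notation, no `sorry`. `K : Type`. No summit statement is proved here; BSD is proved for no curve.

Sibling of `…KummerUnramifiedBadA/B` (Parts 24 §3 / 25 / 26 / 27 re-threaded).  Here:

* §1 (Part 29 §2′) `map_levelIncl_restrictField_eq_zero_of_map_primaryInclusion_eq_zero_of_exponent` — a level-`p^k` local Kummer class at
  `v ∤ p` dies in `H¹(K_v, E[p^{k+m}])` for `m ≥ e`, `p^e` killing the `Γ_{K_v}`-fixed `p^∞`-torsion (binder (E)) in place of
  «additive ⟹ killed by `p`».
* §2 (Part 29 §3′) `map_levelIncl_selmerGroup_le_of_exponent`, `relIndex_selmerGroup_eq_relIndex_comap_range_kummerMapLevel_of_exponent`,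
  `…_of_le_of_exponent` (`n ≥ k + e`).

References: [Rubin2000] Thm. 1.7.3; [Kato2004Asterisque] §14.1 (p. 235), §14.8 (p. 238), (14.9.3) (p. 240); [GreenbergLNM1716] §2, §5
(p. 114); [MilneADT2006] Ch. I Prop. 3.8, Thm. 4.10; [SilvermanAEC2009] VII.3.1, VII.6, VIII.§2.
-/

noncomputable section

open scoped Classical ContRepresentation NumberField
open Function Field NumberField IsDedekindDomain WeierstrassCurve
open Literature.NumberTheory.EllipticCurves Literature.NumberTheory.GaloisRepresentations
  Literature.NumberTheory.GaloisRepresentations.DiscreteGaloisModule Literature.NumberTheory.GaloisCohomology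
open Summit.BirchSwinnertonDyer.Rank1Residual.X11b.Levels Summit.BirchSwinnertonDyer.Rank1Residual.X11b.LocBridge
open Summit.BirchSwinnertonDyer.Rank1Residual.GaloisImage
open Summit.BirchSwinnertonDyer.Rank1Residual.Additive.LevelBridge
open Summit.BirchSwinnertonDyer.Rank1Residual.Additive.KummerUnramified

set_option linter.dupNamespace false

namespace Summit.BirchSwinnertonDyer.BirchSwinnertonDyer.Theorems.ErratumRoadFiveKatoFframeKummerUnramifiedBad

variable {K : Type} [Field K] [NumberField K] (W : WeierstrassCurve K) [W.IsElliptic] (p : ℕ) [hp : Fact p.Prime]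

/-! ## §1 Part 29 §2′: a local Kummer class of level `p^k` dies in `H¹(K_v, E[p^{k+m}])` for `m ≥ e` (binder (E)) -/

omit [W.IsElliptic] hp in
/-- **`levelIncl_* (ker ι_{k,v}) = 0` in `H¹(K_v, E[p^{k+m}])` at `v ∤ p` for `m ≥ e`**, where `p^e` kills the `Γ_{K_v}`-fixed points of
`E[p^∞]` (binder (E)).  A cocycle `φ` of `E[p^k]` with `ι_k φ(σ) = σb − b` has `p^k b` fixed by `Γ_{K_v}`, hence `p^{k+e} b = 0`, so
`b = ι_{k+m} a` and `levelIncl ∘ φ` is the coboundary of `a`. Part 29 §2 verbatim with (E) for «additive ⟹ killed by `p`».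
[cite: GreenbergLNM1716, §5 proof of Prop. 5.8 (p. 114)] [cite: SilvermanAEC2009, Prop. VII.3.1 and Cor. VII.6.2] -/
theorem map_levelIncl_restrictField_eq_zero_of_map_primaryInclusion_eq_zero_of_exponent
    (v : HeightOneSpectrum (𝓞 K)) (k m e : ℕ) (hm : e ≤ m)
    (he : ∀ X : W.geomPrimaryTorsion p,
      (∀ σ : absoluteGaloisGroup (v.adicCompletion K),
        GaloisRep.restrictField (v.adicCompletion K) (primaryGaloisModule W p) σ X = X) → p ^ e • X = 0)
    (c : galoisCohomology (GaloisRep.restrictField (v.adicCompletion K) (W.torsionGaloisModule ((p ^ k : ℕ) : ℤ))) 1)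
    (hc : galoisCohomology.map ((primaryInclusion W p k).restrictField (v.adicCompletion K)) 1 c = 0) :
    galoisCohomology.map ((levelIncl W p k m).restrictField (v.adicCompletion K)) 1 c = 0 := by
  obtain ⟨φ, rfl⟩ := oneCocycleClass_surjective _ c
  obtain ⟨b, hb⟩ := (map_one_oneCocycleClass_eq_zero_iff _ φ).1 hc
  -- `p^k • b` is `Γ_{K_v}`-fixed
  have hfix : ∀ σ : absoluteGaloisGroup (v.adicCompletion K),
      GaloisRep.restrictField (v.adicCompletion K) (primaryGaloisModule W p) σ (p ^ k • b) = p ^ k • b := fun σ => by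
    have h0 : p ^ k • (GaloisRep.restrictField (v.adicCompletion K) (primaryGaloisModule W p) σ b - b) = 0 := by
      rw [← hb σ, ← map_nsmul, pow_nsmul_geomTorsion_eq_zero, map_zero]
    rwa [smul_sub, ← map_nsmul, sub_eq_zero] at h0
  -- binder (E): `p^e` kills the fixed `p`-power torsion, so `p^(k+m) • b = 0`
  have hkill : p ^ (k + m) • b = 0 := by
    have h1 : p ^ e • (p ^ k • b) = 0 := he (p ^ k • b) hfix
    obtain ⟨j, hj⟩ := Nat.exists_eq_add_of_le hm
    have hpow : p ^ (k + m) = p ^ j * (p ^ e * p ^ k) := by rw [hj]; ring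
    rw [hpow, mul_smul, mul_smul, h1, smul_zero]
  obtain ⟨a, ha⟩ := exists_primaryInclusion_restrictField_eq_of_nsmul_eq_zero W p (k + m) (v.adicCompletion K) b hkill
  refine (map_one_oneCocycleClass_eq_zero_iff _ φ).2 ⟨a, fun σ => ?_⟩
  apply primaryInclusion_restrictField_injective W p (k + m) (v.adicCompletion K)
  have h' : (primaryInclusion W p (k + m)).restrictField (v.adicCompletion K)
        (GaloisRep.restrictField (v.adicCompletion K) (W.torsionGaloisModule ((p ^ (k + m) : ℕ) : ℤ)) σ a) =
      GaloisRep.restrictField (v.adicCompletion K) (primaryGaloisModule W p) σ b := by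
    rw [← ha]; exact ((primaryInclusion W p (k + m)).restrictField (v.adicCompletion K)).isIntertwining σ a
  calc (primaryInclusion W p (k + m)).restrictField (v.adicCompletion K)
          ((levelIncl W p k m).restrictField (v.adicCompletion K) (φ.1 σ))
        = (primaryInclusion W p k).restrictField (v.adicCompletion K) (φ.1 σ) :=
          primaryInclusion_levelIncl W p k m (φ.1 σ)
    _ = GaloisRep.restrictField (v.adicCompletion K) (primaryGaloisModule W p) σ b - b := hb σ
    _ = _ := by rw [map_sub, h', ha]

/-! ## §2 Part 29 §3′: `[Sel^{(p^{k+m})} : H¹_{𝓖'}] = [M_{k+m} : M_{k+m} ⊓ H¹_{𝓖'}]` for `m ≥ e` -/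

/-- **`levelIncl_*(Sel^{(p^k)}(E/K)) ≤ H¹_{𝓖'}(K, E[p^{k+m}])`** for every `𝓖'` «`𝓚 ⊓ H¹_ur` at `Σ`, `𝓚` elsewhere», `Σ` finite places `∤ p`
carrying one exponent `e` (binder (E)), `m ≥ e`: the localizations at `Σ` VANISH (§1). Part 29 §3 verbatim.
[cite: GreenbergLNM1716, §5 proof of Prop. 5.8 (p. 114)] [cite: Kato2004Asterisque, §14.8 (p. 238)] -/
theorem map_levelIncl_selmerGroup_le_of_exponent (Q : Finset (HeightOneSpectrum (𝓞 K)))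
    (hQp : ∀ v ∈ Q, ((p : ℕ) : 𝓞 K) ∉ v.asIdeal) (k m e : ℕ) (hm : e ≤ m)
    (heQ : ∀ v ∈ Q, ∀ X : W.geomPrimaryTorsion p,
      (∀ σ : absoluteGaloisGroup (v.adicCompletion K),
        GaloisRep.restrictField (v.adicCompletion K) (primaryGaloisModule W p) σ X = X) → p ^ e • X = 0)
    (𝓖' : SelmerStructure (W.torsionGaloisModule ((p ^ (k + m) : ℕ) : ℤ)))
    (h𝓖'Q : ∀ v ∈ Q, 𝓖' (Sum.inr v) = W.kummerSelmerStructure ((p ^ (k + m) : ℕ) : ℤ) (Sum.inr v) ⊓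
      unramifiedSubgroup (GaloisRep.toLocal v (W.torsionGaloisModule ((p ^ (k + m) : ℕ) : ℤ))) 1)
    (h𝓖'nQ : ∀ v ∉ Q, 𝓖' (Sum.inr v) = W.kummerSelmerStructure ((p ^ (k + m) : ℕ) : ℤ) (Sum.inr v))
    (h𝓖'inl : ∀ w : InfinitePlace K, 𝓖' (Sum.inl w) = W.kummerSelmerStructure ((p ^ (k + m) : ℕ) : ℤ) (Sum.inl w)) :
    ((W.kummerSelmerStructure ((p ^ k : ℕ) : ℤ)).selmerGroup).map
        (galoisCohomology.map (levelIncl W p k m) 1 :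
          galH1Torsion W ((p ^ k : ℕ) : ℤ) →+ galH1Torsion W ((p ^ (k + m) : ℕ) : ℤ)) ≤ 𝓖'.selmerGroup := by
  rintro _ ⟨s, hs, rfl⟩
  have hs' := (SelmerStructure.mem_selmerGroup_iff _ s).1 hs
  -- `levelIncl_* s` is Selmer at level `p^{k+m}`
  have hsel : (galoisCohomology.map (levelIncl W p k m) 1 s) ∈
      (W.kummerSelmerStructure ((p ^ (k + m) : ℕ) : ℤ)).selmerGroup := by
    rw [selmerGroup_kummerSelmerStructure_eq_comap W p (k + m), AddSubgroup.mem_comap]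
    have h : s ∈ (W.kummerSelmerStructure ((p ^ k : ℕ) : ℤ)).selmerGroup := hs
    rw [selmerGroup_kummerSelmerStructure_eq_comap W p k, AddSubgroup.mem_comap] at h
    have e : (galoisCohomology.map (primaryInclusion W p (k + m)) 1 :
          galH1Torsion W ((p ^ (k + m) : ℕ) : ℤ) →+ W.galH1Primary p)
        (galoisCohomology.map (levelIncl W p k m) 1 s) =
        (galoisCohomology.map (primaryInclusion W p k) 1 : galH1Torsion W ((p ^ k : ℕ) : ℤ) →+ W.galH1Primary p) s :=
      map_primaryInclusion_map_levelIncl W p k m s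
    rw [e]; exact h
  have hsel' := (SelmerStructure.mem_selmerGroup_iff _ _).1 hsel
  rw [SelmerStructure.mem_selmerGroup_iff]
  intro u
  rcases u with w | v
  · rw [h𝓖'inl w]; exact hsel' _
  · by_cases hv : v ∈ Q
    · rw [h𝓖'Q v hv]
      -- the localization at `v ∈ Σ` vanishes
      have hn : ((p ^ k : ℕ) : ℤ) ≠ 0 := by exact_mod_cast pow_ne_zero k hp.out.ne_zero
      have hker : galoisCohomology.map ((primaryInclusion W p k).restrictField (v.adicCompletion K)) 1
          (galoisCohomology.localization (W.torsionGaloisModule ((p ^ k : ℕ) : ℤ)) (Sum.inr v) 1 s) = 0 := by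
        have h := hs' (Sum.inr v)
        have e : W.kummerSelmerStructure ((p ^ k : ℕ) : ℤ) (Sum.inr v) =
            (galoisCohomology.map ((primaryInclusion W p k).restrictField (v.adicCompletion K)) 1).ker :=
          Summit.BirchSwinnertonDyer.Rank1Residual.X11b.LevelKummer.kummerLocalConditionAt_eq_ker_map_primaryInclusion W p k v
            (hQp v hv) hn
        rw [e] at h
        exact h
      have h0 : galoisCohomology.localization (W.torsionGaloisModule ((p ^ (k + m) : ℕ) : ℤ)) (Sum.inr v) 1
          (galoisCohomology.map (levelIncl W p k m) 1 s) = 0 := by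
        rw [localization_map_one']
        exact map_levelIncl_restrictField_eq_zero_of_map_primaryInclusion_eq_zero_of_exponent W p v k m e hm (heQ v hv) _ hker
      rw [h0]
      exact zero_mem _
    · rw [h𝓖'nQ v hv]; exact hsel' _

/-- **`[Sel^{(p^{k+m})}(E/K) : H¹_{𝓖'}(K, E[p^{k+m}])] = [M_{k+m} : M_{k+m} ⊓ H¹_{𝓖'}]`, `M_n = ι_n⁻¹ κ_n(E(K))`**, for `m ≥ e` (binder (E)
at `Σ`), `p^k • Sel_{p^∞}(E/K) ⊆ E(K) ⊗ ℚ_p/ℤ_p` (binder `hsha`), every `𝓖'` «`𝓚 ⊓ H¹_ur` at `Σ`, `𝓚` elsewhere». Part 29 §3 verbatim.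
[cite: Kato2004Asterisque, §14.8 (p. 238) and §14.1 (p. 235)] [cite: GreenbergLNM1716, §5 proof of Prop. 5.8 (p. 114)] -/
theorem relIndex_selmerGroup_eq_relIndex_comap_range_kummerMapLevel_of_exponent
    (Q : Finset (HeightOneSpectrum (𝓞 K)))
    (hQp : ∀ v ∈ Q, ((p : ℕ) : 𝓞 K) ∉ v.asIdeal) (k m e : ℕ) (hm : e ≤ m)
    (heQ : ∀ v ∈ Q, ∀ X : W.geomPrimaryTorsion p,
      (∀ σ : absoluteGaloisGroup (v.adicCompletion K),
        GaloisRep.restrictField (v.adicCompletion K) (primaryGaloisModule W p) σ X = X) → p ^ e • X = 0)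
    (hsha : ∀ x ∈ selmerGroupPInfty W p, p ^ k • x ∈ (primaryH1ToH1 W p).ker)
    (𝓖' : SelmerStructure (W.torsionGaloisModule ((p ^ (k + m) : ℕ) : ℤ)))
    (h𝓖'Q : ∀ v ∈ Q, 𝓖' (Sum.inr v) = W.kummerSelmerStructure ((p ^ (k + m) : ℕ) : ℤ) (Sum.inr v) ⊓
      unramifiedSubgroup (GaloisRep.toLocal v (W.torsionGaloisModule ((p ^ (k + m) : ℕ) : ℤ))) 1)
    (h𝓖'nQ : ∀ v ∉ Q, 𝓖' (Sum.inr v) = W.kummerSelmerStructure ((p ^ (k + m) : ℕ) : ℤ) (Sum.inr v))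
    (h𝓖'inl : ∀ w : InfinitePlace K, 𝓖' (Sum.inl w) = W.kummerSelmerStructure ((p ^ (k + m) : ℕ) : ℤ) (Sum.inl w)) :
    𝓖'.selmerGroup.relIndex (W.kummerSelmerStructure ((p ^ (k + m) : ℕ) : ℤ)).selmerGroup =
      𝓖'.selmerGroup.relIndex
        (((kummerMapLevel W p W.zsmul_geomPoints_surjective_holds (k + m)).range).comap
          (galoisCohomology.map (primaryInclusion W p (k + m)) 1 :
            galH1Torsion W ((p ^ (k + m) : ℕ) : ℤ) →+ W.galH1Primary p)) := by
  have hle := selmerGroup_le_comap_range_kummerMapLevel_sup_map_levelIncl W p k m hsha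
  have hIU := map_levelIncl_selmerGroup_le_of_exponent W p Q hQp k m e hm heQ 𝓖' h𝓖'Q h𝓖'nQ h𝓖'inl
  -- `H¹_{𝓖'} ≤ Sel^{(p^{k+m})}`
  have hU : 𝓖'.selmerGroup ≤ (W.kummerSelmerStructure ((p ^ (k + m) : ℕ) : ℤ)).selmerGroup := fun x hx => by
    rw [SelmerStructure.mem_selmerGroup_iff] at hx ⊢
    intro u
    rcases u with w | v
    · rw [← h𝓖'inl w]; exact hx _
    · by_cases hv : v ∈ Q
      · have h' := hx (Sum.inr v); rw [h𝓖'Q v hv] at h'; exact h'.1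
      · rw [← h𝓖'nQ v hv]; exact hx _
  -- `M ≤ Sel^{(p^{k+m})}`
  have hM : ((kummerMapLevel W p W.zsmul_geomPoints_surjective_holds (k + m)).range).comap
        (galoisCohomology.map (primaryInclusion W p (k + m)) 1 :
          galH1Torsion W ((p ^ (k + m) : ℕ) : ℤ) →+ W.galH1Primary p) ≤
      (W.kummerSelmerStructure ((p ^ (k + m) : ℕ) : ℤ)).selmerGroup := by
    rw [selmerGroup_kummerSelmerStructure_eq_comap W p (k + m)]
    refine AddSubgroup.comap_mono ?_
    rintro _ ⟨P, rfl⟩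
    exact W.ker_primaryH1ToH1_le_selmerGroupPInfty p
      (W.primaryH1ToH1_kummerMapLevel p W.zsmul_geomPoints_surjective_holds (k + m) P)
  have heq : (W.kummerSelmerStructure ((p ^ (k + m) : ℕ) : ℤ)).selmerGroup =
      ((kummerMapLevel W p W.zsmul_geomPoints_surjective_holds (k + m)).range).comap
          (galoisCohomology.map (primaryInclusion W p (k + m)) 1 :
            galH1Torsion W ((p ^ (k + m) : ℕ) : ℤ) →+ W.galH1Primary p) ⊔ 𝓖'.selmerGroup :=
    le_antisymm (hle.trans (sup_le_sup_left hIU _)) (sup_le hM hU)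
  rw [heq, AddSubgroup.relIndex_sup_right]

/-- The same for every level `n ≥ k + e` (write `n = k + m`, `m ≥ e`). [cite: Kato2004Asterisque, §14.8 (p. 238)] -/
theorem relIndex_selmerGroup_eq_relIndex_comap_range_kummerMapLevel_of_le_of_exponent
    (Q : Finset (HeightOneSpectrum (𝓞 K)))
    (hQp : ∀ v ∈ Q, ((p : ℕ) : 𝓞 K) ∉ v.asIdeal) (e : ℕ)
    (heQ : ∀ v ∈ Q, ∀ X : W.geomPrimaryTorsion p,
      (∀ σ : absoluteGaloisGroup (v.adicCompletion K),
        GaloisRep.restrictField (v.adicCompletion K) (primaryGaloisModule W p) σ X = X) → p ^ e • X = 0)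
    (k : ℕ) (hsha : ∀ x ∈ selmerGroupPInfty W p, p ^ k • x ∈ (primaryH1ToH1 W p).ker)
    (n : ℕ) (hn : k + e ≤ n)
    (𝓖' : SelmerStructure (W.torsionGaloisModule ((p ^ n : ℕ) : ℤ)))
    (h𝓖'Q : ∀ v ∈ Q, 𝓖' (Sum.inr v) = W.kummerSelmerStructure ((p ^ n : ℕ) : ℤ) (Sum.inr v) ⊓
      unramifiedSubgroup (GaloisRep.toLocal v (W.torsionGaloisModule ((p ^ n : ℕ) : ℤ))) 1)
    (h𝓖'nQ : ∀ v ∉ Q, 𝓖' (Sum.inr v) = W.kummerSelmerStructure ((p ^ n : ℕ) : ℤ) (Sum.inr v))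
    (h𝓖'inl : ∀ w : InfinitePlace K, 𝓖' (Sum.inl w) = W.kummerSelmerStructure ((p ^ n : ℕ) : ℤ) (Sum.inl w)) :
    𝓖'.selmerGroup.relIndex (W.kummerSelmerStructure ((p ^ n : ℕ) : ℤ)).selmerGroup =
      𝓖'.selmerGroup.relIndex
        (((kummerMapLevel W p W.zsmul_geomPoints_surjective_holds n).range).comap
          (galoisCohomology.map (primaryInclusion W p n) 1 :
            galH1Torsion W ((p ^ n : ℕ) : ℤ) →+ W.galH1Primary p)) := by
  obtain ⟨m, rfl⟩ := Nat.exists_eq_add_of_le ((Nat.le_add_right k e).trans hn)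
  exact relIndex_selmerGroup_eq_relIndex_comap_range_kummerMapLevel_of_exponent W p Q hQp k m e (by omega) heQ hsha 𝓖' h𝓖'Q
    h𝓖'nQ h𝓖'inl

end Summit.BirchSwinnertonDyer.BirchSwinnertonDyer.Theorems.ErratumRoadFiveKatoFframeKummerUnramifiedBad

end
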